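import Summits.QuantumFields.YangMills.Theorems.PencilRigidityDiagonalMirrorRPRStubRpClosureDefs

/-!
# Crux `DiagonalMirrorRPR` (stmt-QuantumFields-10604), stub `stub_rpClosure`: the swap on the 45° cover,
# expectations on the box tori, positivity of the lattice Gram matrix

Part of the proof of the registered stub `stub_rpClosure` (S4) of the skeleton
`Cruxes/DiagonalMirrorRPR/Lines/parity_bridge_cold_traces.lean` (crux `DiagonalMirrorRPR`, stmt-QuantumFields-10604,
routes `PencilRigidity` = `MirrorModularBoosts`), split by topic over the modules
`…StubRpClosureDefs` (vocabulary, frames) ← `…StubRpClosureLattice` (swap on the cover, expectations, lattice Gram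
positivity), `…StubRpClosureSupport` (support bookkeeping, test functions) and `…StubRpClosureDensity` (ordered-wedge
density with compact supports) ← `…StubRpClosure` (the limit argument and the stub).

This module (namespace `RpClosure`): §A the swap on the cover — `skewLift (θ^*U) = σ^*(skewLift U)`,
`τ_x σ^* = σ^* τ_{σx}`, the Wilson action density at the origin is `σ^*`-invariant (the `(0,1)` plaquette is read
backwards and `Re tr ρ(g⁻¹) = Re tr ρ(g)` for unitary `ρ`), whence the KEY LATTICE IDENTITY
`Φ̃(h ∘ swap)(U) = Φ̃(h)(θ^*U)` for the smeared curvature field on the cover; §B expectations `⟨·⟩ = texp` —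
continuity and bounds of the weight, `Z > 0`, integrability, linearity, reality, `⟨1⟩ = 1`; and the lattice Gram
positivity `stub_rpClosure_latticePSD`: swap-RP upstairs (`CoverSwapRPAt`) makes `∑ c̄_I c_J ⟨(A_I ∘ θ^*) A_J⟩` a
non-negative real for bounded measurable real observables `A_I` of the closed positive half.

References: Fröhlich–Israel–Lieb–Simon, Comm. Math. Phys. 62 (1978) Thm 2.1; Osterwalder–Seiler, Ann. Phys. 110
(1978) §2; Wilson, Phys. Rev. D 10 (1974).
-/

set_option autoImplicit false

noncomputable section

open scoped SchwartzMap ComplexConjugate InnerProductSpace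
open MeasureTheory Filter Topology
open Literature.MathematicalPhysics.QuantumLattice Literature.MathematicalPhysics.AQFT
  Literature.MathematicalPhysics.QuantumFieldTheory

namespace Summit.QuantumFields.YangMills.Cruxes.DiagonalMirrorRPR.ParityBridgeColdTraces

namespace RpClosure

/-! ## §A Lattice bookkeeping: the swap on the 45° cover and the curvature observable -/

section LatticeSwap

open Literature.Probability.LatticeModels (Site box mem_box)

/-- The coordinate swap `y₀ ↔ y₁` of `ℤ⁴`. -/
def siteSwap (y : Site 4) : Site 4 := fun m => y (Equiv.swap (0 : Fin 4) 1 m)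

/-- `siteSwap` is an involution. -/
theorem siteSwap_siteSwap (y : Site 4) : siteSwap (siteSwap y) = y := by
  funext m; simp [siteSwap, Equiv.swap_apply_self]

/-- `siteSwap` permutes the unit vectors by `σ = (0 1)`. -/
theorem siteSwap_single (i : Fin 4) :
    siteSwap (Pi.single i (1 : ℤ)) = Pi.single (Equiv.swap (0 : Fin 4) 1 i) 1 := by
  funext m
  simp only [siteSwap, Pi.single_apply, Equiv.swap_apply_eq_iff]

/-- The induced swap of `ℤ⁴`-gauge configurations, `(σ^* V)(y, i) = V (siteSwap y, σ i)`. -/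
def edgeSwap {G : Type*} (V : LGConfig 4 G) : LGConfig 4 G :=
  fun e => V (siteSwap e.1, Equiv.swap (0 : Fin 4) 1 e.2)

/-- The skew projection intertwines `siteSwap` with the swap of the cover. -/
theorem skewProj_siteSwap (N : ℕ) [NeZero N] (y : Site 4) :
    skewProj N (siteSwap y) = swapSite (skewProj N y) := by
  simp only [skewProj, swapSite, siteSwap, Equiv.swap_apply_left, Equiv.swap_apply_right,
    map_intCast]
  refine Prod.ext ?_ (Prod.ext ?_ (Prod.ext ?_ ?_))
  · push_cast; ring
  · push_cast; ring
  · simp [Equiv.swap_apply_of_ne_of_ne]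
  · simp [Equiv.swap_apply_of_ne_of_ne]

variable {G : Type}

/-- `skewLift (θ^* U) = σ^* (skewLift U)`. -/
theorem skewLift_swapConfig (N : ℕ) [NeZero N] (U : TConfig (2 * N) N N G) :
    skewLift N (swapConfig U) = edgeSwap (skewLift N U) := by
  funext e
  simp only [skewLift, swapConfig, Function.comp_apply, swapEdge, edgeSwap, skewProj_siteSwap]

/-- Translations and the configuration swap: `τ_x (σ^* V) = σ^* (τ_{σx} V)`. -/
theorem configShift_edgeSwap [MeasurableSpace G] (x : Site 4) (V : LGConfig 4 G) :
    configShift (-x) (edgeSwap V) = edgeSwap (configShift (-(siteSwap x)) V) := by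
  funext e
  simp only [configShift_apply, edgeSwap]
  rfl

variable [Group G] {Nc : ℕ} (ρ : G →* Matrix (Fin Nc) (Fin Nc) ℂ)

/-- The plaquette at the origin in the plane `(i, j)` of `σ^* V` is the plaquette of `V` in the plane
`(σ i, σ j)`. -/
theorem plaquetteObs_edgeSwap (i j : Fin 4) (V : LGConfig 4 G) :
    plaquetteObs ρ 0 i j (edgeSwap V) =
      plaquetteObs ρ 0 (Equiv.swap (0 : Fin 4) 1 i) (Equiv.swap (0 : Fin 4) 1 j) V := by
  have h0 : siteSwap 0 = 0 := rfl
  simp only [plaquetteObs, plaquetteHolonomyZd, edgeSwap, zero_add, siteSwap_single, h0]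

/-- A unitary representation sends inverses to adjoints. -/
theorem map_inv_eq_conjTranspose (hρu : ∀ g, ρ g ∈ Matrix.unitaryGroup (Fin Nc) ℂ) (h : G) :
    ρ h⁻¹ = (ρ h).conjTranspose := by
  -- adapted from `map_inv_eq_conjTranspose` (Literature/QuantumFieldTheory/LatticeGaugeDobrushinPoincare)
  have h1 : ρ h * (ρ h).conjTranspose = 1 := by
    rw [← Matrix.star_eq_conjTranspose]; exact Matrix.mem_unitaryGroup_iff.1 (hρu h)
  calc ρ h⁻¹ = ρ h⁻¹ * (ρ h * (ρ h).conjTranspose) := by rw [h1, mul_one]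
    _ = (ρ h).conjTranspose := by rw [← mul_assoc, ← map_mul, inv_mul_cancel, map_one, one_mul]

/-- `Re tr ρ(h⁻¹) = Re tr ρ(h)` for unitary `ρ`. -/
theorem re_trace_map_inv (hρu : ∀ g, ρ g ∈ Matrix.unitaryGroup (Fin Nc) ℂ) (h : G) :
    (ρ h⁻¹).trace.re = (ρ h).trace.re := by
  -- adapted from `re_trace_map_inv` (Literature/QuantumFieldTheory/LatticeGaugeDobrushinPoincare)
  rw [map_inv_eq_conjTranspose ρ hρu, Matrix.trace_conjTranspose, Complex.star_def, Complex.conj_re]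

/-- Reversing the orientation of a plaquette inverts its holonomy. -/
theorem plaquetteHolonomyZd_symm (V : LGConfig 4 G) (x : Site 4) (i j : Fin 4) :
    plaquetteHolonomyZd V x j i = (plaquetteHolonomyZd V x i j)⁻¹ := by
  simp only [plaquetteHolonomyZd, mul_inv_rev, inv_inv, mul_assoc]

/-- The plaquette observable of a unitary representation does not see the orientation. -/
theorem plaquetteObs_symm (hρu : ∀ g, ρ g ∈ Matrix.unitaryGroup (Fin Nc) ℂ) (x : Site 4) (i j : Fin 4)
    (V : LGConfig 4 G) : plaquetteObs ρ x j i V = plaquetteObs ρ x i j V := by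
  simp only [plaquetteObs]
  rw [plaquetteHolonomyZd_symm, re_trace_map_inv ρ hρu]

/-- **The Wilson action density at the origin is swap invariant** (unitary `ρ`). -/
theorem actionDensity_edgeSwap (hρu : ∀ g, ρ g ∈ Matrix.unitaryGroup (Fin Nc) ℂ) (V : LGConfig 4 G) :
    actionDensity ρ (edgeSwap V) = actionDensity ρ V := by
  simp only [actionDensity, plaquetteObs_edgeSwap, Fin.sum_univ_four, Fin.isValue,
    Equiv.swap_apply_left, Equiv.swap_apply_right]
  have h2 : Equiv.swap (0 : Fin 4) 1 2 = 2 := by decide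
  have h3 : Equiv.swap (0 : Fin 4) 1 3 = 3 := by decide
  simp only [h2, h3, plaquetteObs_symm ρ hρu 0 0 1 V]
  norm_num [Fin.lt_def]
  ring

/-- The swap of `ℝ⁴` matches the swap of `ℤ⁴` on rescaled lattice points. -/
theorem swap01_smul_siteToE (a : ℝ) (x : Site 4) : swap01 (a • siteToE x) = a • siteToE (siteSwap x) := by
  ext m
  simp [swap01, siteSwap]

/-- **Key lattice identity.** Smearing the curvature field against `h ∘ swap` on the cover equals smearing
against `h` after the configuration swap `θ^*`: `Φ̃(h ∘ sw)(U) = Φ̃(h)(θ^* U)`. -/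
theorem smearedLatticeField_swap {G : Type} [Group G] [TopologicalSpace G] [IsTopologicalGroup G]
    [CompactSpace G] [MeasurableSpace G] [BorelSpace G] (r : LatticeRep G) (Lb : ℕ) (a cc m : ℝ)
    (h h' : 𝓢(E4, ℝ)) (hh' : ∀ v, h' v = h (swap01 v)) (N : ℕ) [NeZero N] (U : TConfig (2 * N) N N G) :
    smearedLatticeField r.curvature.F (box 4 Lb) a cc m h' (skewLift N U) =
      smearedLatticeField r.curvature.F (box 4 Lb) a cc m h (skewLift N (swapConfig U)) := by
  unfold smearedLatticeField
  congr 1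
  have hmem : ∀ x ∈ box 4 Lb, siteSwap x ∈ box 4 Lb := fun x hx => by
    rw [mem_box] at hx ⊢
    exact fun m => hx _
  refine Finset.sum_nbij' siteSwap siteSwap hmem hmem (fun x _ => siteSwap_siteSwap x)
    (fun x _ => siteSwap_siteSwap x) fun x _ => ?_
  rw [hh', swap01_smul_siteToE, skewLift_swapConfig, configShift_edgeSwap, siteSwap_siteSwap]
  congr 2
  exact (actionDensity_edgeSwap r.ρ r.mem_unitary _).symm

end LatticeSwap

/-! ## §B Expectations on the box tori: continuity, integrability, linearity, reality -/

section TExp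

variable {n₀ n₁ N : ℕ} [NeZero n₀] [NeZero n₁] [NeZero N]
variable {G : Type} [Group G] [TopologicalSpace G] [IsTopologicalGroup G] [CompactSpace G]
  [MeasurableSpace G] [BorelSpace G] {Nc : ℕ} (ρ : G →* Matrix (Fin Nc) (Fin Nc) ℂ) (β : ℝ) (shear : Bool)

/-- The product Haar measure is a probability measure. -/
instance thaar.instIsProbabilityMeasure :
    IsProbabilityMeasure (thaar n₀ n₁ N : Measure (TConfig n₀ n₁ N G)) := by
  unfold thaar; infer_instance

omit [MeasurableSpace G] [BorelSpace G] [CompactSpace G] in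
/-- Wilson's action on the box torus is continuous for a continuous representation. -/
theorem continuous_taction (hρ : Continuous ρ) :
    Continuous (taction (n₀ := n₀) (n₁ := n₁) (N := N) ρ shear) := by
  unfold taction tplaq
  refine continuous_finsetSum _ fun x _ => continuous_finsetSum _ fun i _ =>
    continuous_finsetSum _ fun j _ => ?_
  split_ifs
  · exact Complex.continuous_re.comp (Continuous.matrix_trace (hρ.comp (by fun_prop)))
  · exact continuous_const

omit [MeasurableSpace G] [BorelSpace G] [CompactSpace G] in
/-- The Boltzmann weight is continuous. -/
theorem continuous_tweight (hρ : Continuous ρ) :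
    Continuous (tweight (n₀ := n₀) (n₁ := n₁) (N := N) ρ β shear) :=
  Real.continuous_exp.comp (continuous_const.mul (continuous_taction ρ shear hρ))

omit [MeasurableSpace G] [BorelSpace G] in
/-- The Boltzmann weight is bounded. -/
theorem exists_tweight_le (hρ : Continuous ρ) :
    ∃ C : ℝ, ∀ U : TConfig n₀ n₁ N G, tweight ρ β shear U ≤ C := by
  obtain ⟨C, hC⟩ := (isCompact_univ.image
    (continuous_tweight (n₀ := n₀) (n₁ := n₁) (N := N) ρ β shear hρ)).isBounded.bddAbove
  exact ⟨C, fun U => hC ⟨U, Set.mem_univ _, rfl⟩⟩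

omit [TopologicalSpace G] [IsTopologicalGroup G] [CompactSpace G] [MeasurableSpace G] [BorelSpace G] in
/-- The Boltzmann weight is positive. -/
theorem tweight_pos (U : TConfig n₀ n₁ N G) : 0 < tweight ρ β shear U := Real.exp_pos _

variable [SecondCountableTopology G]

omit [CompactSpace G] in
/-- The Boltzmann weight is measurable (second countability makes the product Borel). -/
theorem measurable_tweight (hρ : Continuous ρ) :
    Measurable (tweight (n₀ := n₀) (n₁ := n₁) (N := N) ρ β shear : TConfig n₀ n₁ N G → ℝ) :=
  (continuous_tweight ρ β shear hρ).measurable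

/-- A bounded measurable observable times the weight is integrable. -/
theorem integrable_mul_tweight (hρ : Continuous ρ) {F : TConfig n₀ n₁ N G → ℂ} (hF : Measurable F)
    (hb : ∃ C : ℝ, ∀ U, ‖F U‖ ≤ C) :
    Integrable (fun U => F U * ((tweight ρ β shear U : ℝ) : ℂ)) (thaar n₀ n₁ N) := by
  obtain ⟨C, hC⟩ := hb
  obtain ⟨W, hW⟩ := exists_tweight_le (n₀ := n₀) (n₁ := n₁) (N := N) ρ β shear hρ
  refine Integrable.of_bound
    (hF.mul (Complex.measurable_ofReal.comp (measurable_tweight ρ β shear hρ))).aestronglyMeasurable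
    (C * W) (Eventually.of_forall fun U => ?_)
  rw [norm_mul, Complex.norm_real, Real.norm_of_nonneg (tweight_pos ρ β shear U).le]
  have h0 : 0 ≤ C := (norm_nonneg _).trans (hC U)
  exact mul_le_mul (hC U) (hW U) (tweight_pos ρ β shear U).le h0

/-- The partition function is positive. -/
theorem tZ_pos (hρ : Continuous ρ) : 0 < tZ ρ n₀ n₁ N β shear (G := G) := by
  unfold tZ tweight
  refine integral_exp_pos ?_
  obtain ⟨W, hW⟩ := exists_tweight_le (n₀ := n₀) (n₁ := n₁) (N := N) ρ β shear hρ
  refine Integrable.of_bound (measurable_tweight ρ β shear hρ).aestronglyMeasurable W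
    (Eventually.of_forall fun U => ?_)
  rw [Real.norm_of_nonneg (Real.exp_pos _).le]
  exact hW U

omit [SecondCountableTopology G] in
/-- The expectation of a real observable is real: `⟨φ⟩ = ((∫ φ w) / Z : ℝ)`. -/
theorem texp_ofReal (φ : TConfig n₀ n₁ N G → ℝ) :
    texp ρ β shear (fun U => ((φ U : ℝ) : ℂ)) =
      (((∫ U, φ U * tweight ρ β shear U ∂(thaar n₀ n₁ N)) / tZ ρ n₀ n₁ N β shear : ℝ) : ℂ) := by
  unfold texp
  rw [Complex.ofReal_div, ← integral_complex_ofReal]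
  simp only [Complex.ofReal_mul]

omit [SecondCountableTopology G] in
/-- The expectation of a real observable equals (the cast of) its real part. -/
theorem texp_ofReal_eq_re (φ : TConfig n₀ n₁ N G → ℝ) :
    texp ρ β shear (fun U => ((φ U : ℝ) : ℂ)) = (((texp ρ β shear fun U => ((φ U : ℝ) : ℂ)).re : ℝ) : ℂ) := by
  rw [texp_ofReal, Complex.ofReal_re]

/-- `⟨1⟩ = 1`. -/
theorem texp_one (hρ : Continuous ρ) : texp ρ β shear (fun _ : TConfig n₀ n₁ N G => (1 : ℂ)) = 1 := by
  have h := texp_ofReal (n₀ := n₀) (n₁ := n₁) (N := N) ρ β shear (fun _ => (1 : ℝ))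
  simp only [Complex.ofReal_one, one_mul] at h
  rw [h, ← tZ, div_self (tZ_pos ρ β shear hρ).ne', Complex.ofReal_one]

omit [SecondCountableTopology G] in
/-- Linearity of the expectation on finite combinations of integrable observables. -/
theorem texp_sum_mul {ι : Type*} (s : Finset ι) (c : ι → ℂ) (F : ι → TConfig n₀ n₁ N G → ℂ)
    (hF : ∀ i ∈ s, Integrable (fun U => F i U * ((tweight ρ β shear U : ℝ) : ℂ)) (thaar n₀ n₁ N)) :
    texp ρ β shear (fun U => ∑ i ∈ s, c i * F i U) = ∑ i ∈ s, c i * texp ρ β shear (F i) := by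
  unfold texp
  simp only [mul_div_assoc']
  rw [← Finset.sum_div]
  congr 1
  simp only [Finset.sum_mul, mul_assoc]
  rw [integral_finsetSum _ fun i hi => (hF i hi).const_mul (c i)]
  exact Finset.sum_congr rfl fun i _ => integral_const_mul _ _

end TExp


section CoverMeasurable

variable {N : ℕ} [NeZero N] {G : Type} [MeasurableSpace G]

omit [NeZero N] in
/-- The skew lift is measurable. -/
theorem measurable_skewLift : Measurable (skewLift (G := G) N : TConfig (2 * N) N N G → LGConfig 4 G) :=
  measurable_pi_lambda _ fun _ => measurable_pi_apply _

omit [NeZero N] in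
/-- The configuration swap is measurable. -/
theorem measurable_swapConfig : Measurable (swapConfig (G := G) (N := N)) :=
  measurable_pi_lambda _ fun _ => measurable_pi_apply _

end CoverMeasurable

/-! ## §H₁ Swap-RP of the cover on finite families -/

section PSD

variable {G : Type} [Group G] [TopologicalSpace G] [IsTopologicalGroup G] [CompactSpace G]
  [MeasurableSpace G] [BorelSpace G]

omit [IsTopologicalGroup G] [MeasurableSpace G] [BorelSpace G] in
/-- A faithful continuous matrix representation makes `G` second countable. -/
theorem secondCountable_of_rep (r : LatticeRep G) : SecondCountableTopology G :=
  (r.continuous.isClosedEmbedding r.injective).isEmbedding.secondCountableTopology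

/-- **Swap-RP of the cover on finite families (the lattice Gram matrix is Hermitian positive).** For bounded
measurable real observables `A_I` of the closed positive half and coefficients `c_I`,
`∑_{I,J} c̄_I c_J ⟨(A_I ∘ θ^*) · A_J⟩ = ⟨conj(F ∘ θ^*) · F⟩ ≥ 0` with `F = ∑_J c_J A_J`. -/
theorem lattice_psd (r : LatticeRep G) (β : ℝ) (N : ℕ) [NeZero N] (hRP : CoverSwapRPAt r.ρ β N)
    {ι : Type} [Fintype ι] (A : ι → TConfig (2 * N) N N G → ℝ) (hAm : ∀ I, Measurable (A I))
    (hAb : ∀ I, ∃ C : ℝ, ∀ U, |A I U| ≤ C) (hAd : ∀ I, DependsOn (A I) (posEdges N)) (coef : ι → ℂ) :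
    let z := ∑ I, ∑ J, conj (coef I) * coef J *
      texp r.ρ β true (fun U => ((A I (swapConfig U) * A J U : ℝ) : ℂ))
    0 ≤ z.re ∧ z.im = 0 := by
  intro z
  haveI : SecondCountableTopology G := secondCountable_of_rep r
  let Fc : TConfig (2 * N) N N G → ℂ := fun U => ∑ J, coef J * ((A J U : ℝ) : ℂ)
  have hFm : Measurable Fc :=
    Finset.measurable_sum _ fun J _ => (Complex.measurable_ofReal.comp (hAm J)).const_mul _
  choose C hC using hAb
  have hFb : ∃ C₀ : ℝ, ∀ U, ‖Fc U‖ ≤ C₀ := by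
    refine ⟨∑ J, ‖coef J‖ * C J, fun U => (norm_sum_le _ _).trans (Finset.sum_le_sum fun J _ => ?_)⟩
    rw [norm_mul, Complex.norm_real, Real.norm_eq_abs]
    exact mul_le_mul_of_nonneg_left (hC J U) (norm_nonneg _)
  have hFd : DependsOn Fc (posEdges N) := fun U V hUV =>
    Finset.sum_congr rfl fun J _ => by rw [hAd J hUV]
  have hint : ∀ I J, Integrable (fun U => ((A I (swapConfig U) * A J U : ℝ) : ℂ) * ((tweight r.ρ β true U : ℝ) : ℂ))
      (thaar (2 * N) N N) := fun I J => by
    refine integrable_mul_tweight r.ρ β true r.continuous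
      (Complex.measurable_ofReal.comp (((hAm I).comp measurable_swapConfig).mul (hAm J)))
      ⟨C I * C J, fun U => ?_⟩
    rw [Complex.norm_real, Real.norm_eq_abs, abs_mul]
    exact mul_le_mul (hC I _) (hC J _) (abs_nonneg _) ((abs_nonneg _).trans (hC I (swapConfig U)))
  have hz : z = texp r.ρ β true fun U => conj (Fc (swapConfig U)) * Fc U := by
    have hfun : (fun U => conj (Fc (swapConfig U)) * Fc U) = fun U => ∑ I, conj (coef I) *
        ∑ J, coef J * ((A I (swapConfig U) * A J U : ℝ) : ℂ) := by
      funext U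
      simp only [Fc, map_sum, map_mul, Complex.conj_ofReal]
      rw [Finset.sum_mul_sum]
      refine Finset.sum_congr rfl fun I _ => ?_
      rw [Finset.mul_sum]
      refine Finset.sum_congr rfl fun J _ => ?_
      push_cast
      ring
    rw [hfun, texp_sum_mul r.ρ β true _ _ _ fun I _ => ?_]
    · simp only [z]
      refine Finset.sum_congr rfl fun I _ => ?_
      rw [texp_sum_mul r.ρ β true _ _ _ fun J _ => hint I J, Finset.mul_sum]
      refine Finset.sum_congr rfl fun J _ => ?_
      ring
    · simp only [Finset.sum_mul]
      refine integrable_finsetSum _ fun J _ => ?_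
      simp only [mul_assoc]
      exact (hint I J).const_mul _
  rw [hz]
  exact hRP Fc hFm hFb hFd

/-- **Sub-goal `stub_rpClosure_latticePSD` of `stub_rpClosure` (the lattice Gram matrix is Hermitian positive).**
Swap-RP of Wilson's measure on the 45° cover (`CoverSwapRPAt`) applied to `F = ∑_J c_J A_J`:
`∑_{I,J} c̄_I c_J ⟨(A_I ∘ θ^*) · A_J⟩ = ⟨conj(F ∘ θ^*) · F⟩` is a non-negative real. -/
theorem stub_rpClosure_latticePSD :
    ∀ {G : Type} [Group G] [TopologicalSpace G] [IsTopologicalGroup G] [CompactSpace G] [MeasurableSpace G]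
      [BorelSpace G] (r : LatticeRep G) (β : ℝ) (N : ℕ) [NeZero N], CoverSwapRPAt r.ρ β N →
      ∀ {ι : Type} [Fintype ι] (A : ι → TConfig (2 * N) N N G → ℝ), (∀ I, Measurable (A I)) →
        (∀ I, ∃ C : ℝ, ∀ U, |A I U| ≤ C) → (∀ I, DependsOn (A I) (posEdges N)) → ∀ (coef : ι → ℂ),
          0 ≤ (∑ I, ∑ J, conj (coef I) * coef J *
              texp r.ρ β true (fun U => ((A I (swapConfig U) * A J U : ℝ) : ℂ))).re ∧
            (∑ I, ∑ J, conj (coef I) * coef J *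
              texp r.ρ β true (fun U => ((A I (swapConfig U) * A J U : ℝ) : ℂ))).im = 0 :=
  fun r β N _ hRP _ _ A hAm hAb hAd coef => lattice_psd r β N hRP A hAm hAb hAd coef

end PSD

end RpClosure

end Summit.QuantumFields.YangMills.Cruxes.DiagonalMirrorRPR.ParityBridgeColdTraces

end
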